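import Summits.KontsevichZagierPeriods.KontsevichZagierPeriods.Theses.FurushoPentagon
import Summits.KontsevichZagierPeriods.KontsevichZagierPeriods.Theorems.FurushoPentagonPentagonInKZCornersCubicalChartsA
import Summits.KontsevichZagierPeriods.KontsevichZagierPeriods.Theorems.FurushoPentagonPentagonInKZCornersCubicalC5

/-!
# `PentagonInKZ` (stmt-KontsevichZagierPeriods-11348), line `edge-normal-newton-leibniz`:
# stub `stub_cornersCubical`

The log-free CORNER PRINCIPLE (hypothesis, verbatim the statement of the lead's stub
`stub_cornerPrinciple`) instantiated at the three CUBICAL vertices of the pentagon cell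
`{0 < x < y < 1}` of `M₀,₅(ℝ)` read in the chart `x = uv, y = v`:

* C1, vertex `(0,0)`, chart `(ξ,η) = (u,v)`, divisors `ξ, η, 1-ξ, 1-η, 1-ξη`, residues
  `t₀₁, t₀₁+t₀₂+t₁₂, t₁₂, t₂₃, t₁₃` — gives `M0·M5 = M4·M6`;
* C2, vertex `(1,0)`, chart `(1-u, v)`, fifth divisor `1-η+ξη`, residues
  `t₁₂, t₀₁+t₀₂+t₁₂, t₀₁, t₂₃, t₁₃` — gives `M0·M7 = M1·M8`;
* C5, vertex `(0,1)`, chart `(u, 1-v)`, fifth divisor `1-ξ+ξη`, residues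
  `t₀₁, t₂₃, t₁₂, t₀₁+t₀₂+t₁₂, t₁₃` — gives `M4·M14 = M3·M13`

(`M p` = the end-regularised transport of the atlas path `p`, see the first lead's skeleton
`Cruxes/PentagonInKZ/Lines/logfree-gauge-corner-flatness.lean`).  For each chart the corner
principle (`CornersCubical.chart_Cj`) yields `V_½(½)·H_0(½) = H_½(½)·V_0(½)` over the chart
alphabet `Fin 5`; each side is then identified with an atlas path
(`CornersCubical.side_transport_pl`):
letters of density `0` on the side are dead (their words vanish after end regularisation, which
preserves letter counts), live letters map to the atlas letter with the same density (classes
identified word by word by `KZ.of_sub_of_mem_relations_of_eqOn`), and letters with equal densities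
merge with added residues (`C2`: `t₂₃ + t₁₃` on `V_0`; `C5`: `t₁₂ + t₁₃` on `H_0`).

References: [Drinfeld1991, §2], [Furusho2011, §2], [KontsevichZagier2001, §1.2],
[IharaKanekoZagier2006, Cor. 5], [BrownModuli2009, §2].
-/

noncomputable section

open Literature.NumberTheory.Transcendental

namespace Summit.KontsevichZagierPeriods.FurushoPentagon.PentagonInKZ

/-- **Stub `stub_cornersCubical`**: the corner principle (hypothesis, verbatim the statement of
`stub_cornerPrinciple`) instantiated at the three CUBICAL vertices of the pentagon cell
`{0 < x < y < 1}` read in the chart `x = uv, y = v` — vertex `(0,0)` (chart `(u,v)`, divisors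
`u, v, 1-u, 1-v, 1-uv`, residues `t₀₁, t₀₁+t₀₂+t₁₂, t₁₂, t₂₃, t₁₃`), vertex `(1,0)` (chart
`(1-u, v)`, fifth divisor `1-v+ξv`), vertex `(0,1)` (chart `(u, 1-v)`, fifth divisor `1-ξ+ξη`) —
gives the corner identities `M0M5 = M4M6`, `M0M7 = M1M8`, `M4M14 = M3M13` of the fifteen-path
atlas (words of the atlas alphabet `Fin 3` embed into the chart alphabet `Fin 5`; letters with
equal densities on an edge merge with added residues; classes are identified by
`KZ.of_sub_of_mem_relations_of_eqOn`). [cite: Drinfeld1991, §2] -/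
theorem stub_cornersCubical :
    (∀ (R : Type) [CommRing R] [Algebra ℚ R] (χ : KZ.FormalRep →+ R), (∀ c ∈ KZ.relations, χ c = 0) → (∀ x y : KZ.FormalRep, χ (x * y) = χ x * χ y) → (∃ u : KZ.FormalRep, χ u = 1) → ∀ (m N : ℕ) (α β : ℚ), 0 < α → 0 < β → ∀ (cf : Fin (m + 2) → Fin 4 → ℚ), cf 0 = ![0, 1, 0, 0] → cf 1 = ![0, 0, 1, 0] → ∀ (φ f g : Fin (m + 2) → ℝ → ℝ → ℝ), (∀ k x y, φ k x y = cf k 0 + cf k 1 * x + cf k 2 * y + cf k 3 * x * y) → (∀ k x y, f k x y = (cf k 1 + cf k 3 * y) / φ k x y) → (∀ k x y, g k x y = (cf k 2 + cf k 3 * x) / φ k x y) → (∀ k : Fin (m + 2), k ≠ 0 → k ≠ 1 → ∀ x y : ℝ, 0 ≤ x → x ≤ (α : ℝ) → 0 ≤ y → y ≤ (β : ℝ) → φ k x y ≠ 0) → ∀ (nZ : Fin (m + 2) → Fin 4 → Fin 4 → ℤ) (Zr : Fin (m + 2) → DrinfeldKohnoTrunc ℝ (Fin 4) N), (∀ k,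 Zr k = ∑ i : Fin 4, ∑ j : Fin 4, (nZ k i j : ℝ) • DrinfeldKohnoTrunc.t ℝ N i j) → Zr 0 * Zr 1 = Zr 1 * Zr 0 → (∀ x y : ℝ, 0 < x → x < (α : ℝ) → 0 < y → y < (β : ℝ) → ∑ k : Fin (m + 2), ∑ l : Fin (m + 2), (f k x y * g l x y) • (Zr k * Zr l - Zr l * Zr k) = 0) → (∀ y : ℝ, 0 < y → y < (β : ℝ) → ∑ l : Fin (m + 2), g l 0 y • (Zr 0 * Zr l - Zr l * Zr 0) = 0) → (∀ x : ℝ, 0 < x → x < (α : ℝ) → ∑ k : Fin (m + 2), f k x 0 • (Zr 1 * Zr k - Zr k * Zr 1) = 0) → ∀ (IHlo IHhi IVlo IVhi : (w : List (Fin (m + 2))) → KZ.IntegralRep w.length), (∀ w : List (Fin (m + 2)), w.getLast? ≠ some 0 → (IHlo w).domain = {t | (∀ i, 0 < t i ∧ t i < (α : ℝ)) ∧ StrictAnti t} ∧ Set.EqOn (IHlo w).integrand (fun t => ∏ i, f (w.get i) (t i) 0) (IHlo w).domain) → (∀ w : List (Fin (m + 2)), w.getLast? ≠ some 0 → (IHhi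 w).domain = {t | (∀ i, 0 < t i ∧ t i < (α : ℝ)) ∧ StrictAnti t} ∧ Set.EqOn (IHhi w).integrand (fun t => ∏ i, f (w.get i) (t i) (β : ℝ)) (IHhi w).domain) → (∀ w : List (Fin (m + 2)), w.getLast? ≠ some 1 → (IVlo w).domain = {t | (∀ i, 0 < t i ∧ t i < (β : ℝ)) ∧ StrictAnti t} ∧ Set.EqOn (IVlo w).integrand (fun t => ∏ i, g (w.get i) 0 (t i)) (IVlo w).domain) → (∀ w : List (Fin (m + 2)), w.getLast? ≠ some 1 → (IVhi w).domain = {t | (∀ i, 0 < t i ∧ t i < (β : ℝ)) ∧ StrictAnti t} ∧ Set.EqOn (IVhi w).integrand (fun t => ∏ i, g (w.get i) (α : ℝ) (t i)) (IVhi w).domain) → ∀ (PHlo PHhi PVlo PVhi : NCSeries (Fin (m + 2)) R), (∀ W, PHlo W = if W = [] then 1 else Shuffle.pair (fun w => χ (KZ.of (IHlo w))) (Shuffle.regEnd 0 W)) → (∀ W, PHhi W = if W = [] then 1 else Shuffle.pair (fun w => χ (KZ.of (IHhi w))) (Shuffle.regEnd 0 W)) → (∀ W, PVlo W = if W = [] then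 1 else Shuffle.pair (fun w => χ (KZ.of (IVlo w))) (Shuffle.regEnd 1 W)) → (∀ W, PVhi W = if W = [] then 1 else Shuffle.pair (fun w => χ (KZ.of (IVhi w))) (Shuffle.regEnd 1 W)) → ∀ (Z : Fin (m + 2) → DrinfeldKohnoTrunc R (Fin 4) N), (∀ k, Z k = ∑ i : Fin 4, ∑ j : Fin 4, (nZ k i j : R) • DrinfeldKohnoTrunc.t R N i j) → NCSeries.evalTrunc N Z PVhi * NCSeries.evalTrunc N Z PHlo = NCSeries.evalTrunc N Z PHhi * NCSeries.evalTrunc N Z PVlo) → ∀ (R : Type) [CommRing R] [Algebra ℚ R] (χ : KZ.FormalRep →+ R), (∀ c ∈ KZ.relations, χ c = 0) → (∀ x y : KZ.FormalRep, χ (x * y) = χ x * χ y) → (∃ u : KZ.FormalRep, χ u = 1) → ∀ (I : (p : Fin 15) → (w : List (Fin 3)) → KZ.IntegralRep w.length), (∀ (p : Fin 15) (w : List (Fin 3)), w.getLast? ≠ some 0 → (I p w).domain = {t | (∀ i, 0 < t i ∧ t i < (![1/2, 1/2, 1/2, 1/2, 1/2, 1/2, 1/2, 1/2, 1/2, 1/2,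 1, 1, 1/2, 1/2, 1/2] : Fin 15 → ℝ) p) ∧ StrictAnti t} ∧ Set.EqOn (I p w).integrand (fun t => ∏ i, 1 / (t i - (![![0, 1, 2], ![0, 1, -1], ![0, 1, 2], ![0, 1, -1], ![0, 1, 2], ![0, 1, 2], ![0, 1, 2], ![0, 1, 2], ![0, 1, 2], ![0, 1, 2], ![0, -1, 2], ![0, -1, 2], ![0, 1, 2], ![0, 1, 2], ![0, 1, 2]] : Fin 15 → Fin 3 → ℝ) p (w.get i))) (I p w).domain) → ∀ (P : Fin 15 → NCSeries (Fin 3) R), (∀ (p : Fin 15) (W : List (Fin 3)), P p W = if W = [] then 1 else Shuffle.pair (fun w => χ (KZ.of (I p w))) (Shuffle.regEnd 0 W)) → ∀ (N : ℕ) (a b c d e : DrinfeldKohnoTrunc R (Fin 4) N), a = DrinfeldKohnoTrunc.t R N 0 1 → b = DrinfeldKohnoTrunc.t R N 0 2 → c = DrinfeldKohnoTrunc.t R N 1 2 → d = DrinfeldKohnoTrunc.t R N 1 3 → e = DrinfeldKohnoTrunc.t R N 2 3 → ∀ (M : Fin 15 → DrinfeldKohnoTrunc R (Fin 4) N), (∀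 p : Fin 15, M p = NCSeries.evalTrunc N ((![![a + b + c, e, d], ![c, a, d], ![c + d + e, a + a + b + c, d], ![e, a + b + c, d], ![a, c, d], ![a, c, 0], ![a + b + c, e, 0], ![c, a, 0], ![a + b + c, d + e, 0], ![c + d + e, a + b + c, 0], ![c, d, 0], ![e, d, 0], ![c + d + e, a, 0], ![a, c + d, 0], ![e, a + b + c, 0]] : Fin 15 → Fin 3 → DrinfeldKohnoTrunc R (Fin 4) N) p) (P p)) → M 0 * M 5 = M 4 * M 6 ∧ M 0 * M 7 = M 1 * M 8 ∧ M 4 * M 14 = M 3 * M 13 := by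
  intro CP R _ _ χ hrel hmul hunit I hI P hP N a b c d e ha hb hc hd he M hM
  have hq : ((1 / 2 : ℚ) : ℝ) = 2⁻¹ := by norm_num
  have C1 : M 0 * M 5 = M 4 * M 6 := by
    obtain ⟨f, g, hfg, IHlo, IHhi, IVlo, IVhi, hIHlo, hIHhi, hIVlo, hIVhi, PHlo, PHhi, PVlo, PVhi,
      hPHlo, hPHhi, hPVlo, hPVhi, key⟩ := CornersCubical.chart_C1 CP R χ hrel hmul hunit N
      (![a, a + b + c, c, e, d] : Fin 5 → DrinfeldKohnoTrunc R (Fin 4) N)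
      (by subst ha hb hc hd he; rfl)
    have TC1Vh :
        NCSeries.evalTrunc N
          (![a, a + b + c, c, e, d] : Fin 5 → DrinfeldKohnoTrunc R (Fin 4) N) PVhi = M 0 := by
      rw [hM]
      refine CornersCubical.side_transport_pl χ hrel ((1 / 2 : ℚ) : ℝ)
        (fun k s => g k ((1 / 2 : ℚ) : ℝ) s) _ 1 0
        (![none, some 0, none, some 1, some 2] : Fin 5 → Option (Fin 3)) rfl (by decide) ?_
        IVhi hIVhi (I 0) _ (by simp) (hI 0) PVhi hPVhi (P 0) (hP 0) N _ _ ?_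
      · intro i s _ _
        obtain ⟨-, -, -, ⟨e0, e1, e2, e3, e4⟩⟩ := CornersCubical.edge_C1 f g hfg s
        simp only [hq]
        fin_cases i <;> simp [e0, e1, e2, e3, e4]
      · intro b
        fin_cases b <;> simp [Finset.sum_filter, Fin.sum_univ_five]
    have TC1H0 :
        NCSeries.evalTrunc N
          (![a, a + b + c, c, e, d] : Fin 5 → DrinfeldKohnoTrunc R (Fin 4) N) PHlo = M 5 := by
      rw [hM]
      refine CornersCubical.side_transport_pl χ hrel ((1 / 2 : ℚ) : ℝ)
        (fun k s => f k s 0) _ 0 0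
        (![some 0, none, some 1, none, none] : Fin 5 → Option (Fin 3)) rfl (by decide) ?_
        IHlo hIHlo (I 5) _ (by simp) (hI 5) PHlo hPHlo (P 5) (hP 5) N _ _ ?_
      · intro i s _ _
        obtain ⟨⟨e0, e1, e2, e3, e4⟩, -, -, -⟩ := CornersCubical.edge_C1 f g hfg s
        fin_cases i <;> simp [e0, e1, e2, e3, e4]
      · intro b
        fin_cases b <;> simp [Finset.sum_filter, Fin.sum_univ_five]
    have TC1Hh :
        NCSeries.evalTrunc N
          (![a, a + b + c, c, e, d] : Fin 5 → DrinfeldKohnoTrunc R (Fin 4) N) PHhi = M 4 := by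
      rw [hM]
      refine CornersCubical.side_transport_pl χ hrel ((1 / 2 : ℚ) : ℝ)
        (fun k s => f k s ((1 / 2 : ℚ) : ℝ)) _ 0 0
        (![some 0, none, some 1, none, some 2] : Fin 5 → Option (Fin 3)) rfl (by decide) ?_
        IHhi hIHhi (I 4) _ (by simp) (hI 4) PHhi hPHhi (P 4) (hP 4) N _ _ ?_
      · intro i s _ _
        obtain ⟨-, ⟨e0, e1, e2, e3, e4⟩, -, -⟩ := CornersCubical.edge_C1 f g hfg s
        simp only [hq]
        fin_cases i <;> simp [e0, e1, e2, e3, e4]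
      · intro b
        fin_cases b <;> simp [Finset.sum_filter, Fin.sum_univ_five]
    have TC1V0 :
        NCSeries.evalTrunc N
          (![a, a + b + c, c, e, d] : Fin 5 → DrinfeldKohnoTrunc R (Fin 4) N) PVlo = M 6 := by
      rw [hM]
      refine CornersCubical.side_transport_pl χ hrel ((1 / 2 : ℚ) : ℝ)
        (fun k s => g k 0 s) _ 1 0
        (![none, some 0, none, some 1, none] : Fin 5 → Option (Fin 3)) rfl (by decide) ?_
        IVlo hIVlo (I 6) _ (by simp) (hI 6) PVlo hPVlo (P 6) (hP 6) N _ _ ?_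
      · intro i s _ _
        obtain ⟨-, -, ⟨e0, e1, e2, e3, e4⟩, -⟩ := CornersCubical.edge_C1 f g hfg s
        fin_cases i <;> simp [e0, e1, e2, e3, e4]
      · intro b
        fin_cases b <;> simp [Finset.sum_filter, Fin.sum_univ_five]
    rw [TC1Vh, TC1H0, TC1Hh, TC1V0] at key
    exact key
  have C2 : M 0 * M 7 = M 1 * M 8 := by
    obtain ⟨f, g, hfg, IHlo, IHhi, IVlo, IVhi, hIHlo, hIHhi, hIVlo, hIVhi, PHlo, PHhi, PVlo, PVhi,
      hPHlo, hPHhi, hPVlo, hPVhi, key⟩ := CornersCubical.chart_C2 CP R χ hrel hmul hunit N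
      (![c, a + b + c, a, e, d] : Fin 5 → DrinfeldKohnoTrunc R (Fin 4) N)
      (by subst ha hb hc hd he; rfl)
    have TC2Vh :
        NCSeries.evalTrunc N
          (![c, a + b + c, a, e, d] : Fin 5 → DrinfeldKohnoTrunc R (Fin 4) N) PVhi = M 0 := by
      rw [hM]
      refine CornersCubical.side_transport_pl χ hrel ((1 / 2 : ℚ) : ℝ)
        (fun k s => g k ((1 / 2 : ℚ) : ℝ) s) _ 1 0
        (![none, some 0, none, some 1, some 2] : Fin 5 → Option (Fin 3)) rfl (by decide) ?_
        IVhi hIVhi (I 0) _ (by simp) (hI 0) PVhi hPVhi (P 0) (hP 0) N _ _ ?_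
      · intro i s _ _
        obtain ⟨-, -, -, ⟨e0, e1, e2, e3, e4⟩⟩ := CornersCubical.edge_C2 f g hfg s
        simp only [hq]
        fin_cases i <;> simp [e0, e1, e2, e3, e4]
      · intro b
        fin_cases b <;> simp [Finset.sum_filter, Fin.sum_univ_five]
    have TC2H0 :
        NCSeries.evalTrunc N
          (![c, a + b + c, a, e, d] : Fin 5 → DrinfeldKohnoTrunc R (Fin 4) N) PHlo = M 7 := by
      rw [hM]
      refine CornersCubical.side_transport_pl χ hrel ((1 / 2 : ℚ) : ℝ)
        (fun k s => f k s 0) _ 0 0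
        (![some 0, none, some 1, none, none] : Fin 5 → Option (Fin 3)) rfl (by decide) ?_
        IHlo hIHlo (I 7) _ (by simp) (hI 7) PHlo hPHlo (P 7) (hP 7) N _ _ ?_
      · intro i s _ _
        obtain ⟨⟨e0, e1, e2, e3, e4⟩, -, -, -⟩ := CornersCubical.edge_C2 f g hfg s
        fin_cases i <;> simp [e0, e1, e2, e3, e4]
      · intro b
        fin_cases b <;> simp [Finset.sum_filter, Fin.sum_univ_five]
    have TC2Hh :
        NCSeries.evalTrunc N
          (![c, a + b + c, a, e, d] : Fin 5 → DrinfeldKohnoTrunc R (Fin 4) N) PHhi = M 1 := by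
      rw [hM]
      refine CornersCubical.side_transport_pl χ hrel ((1 / 2 : ℚ) : ℝ)
        (fun k s => f k s ((1 / 2 : ℚ) : ℝ)) _ 0 0
        (![some 0, none, some 1, none, some 2] : Fin 5 → Option (Fin 3)) rfl (by decide) ?_
        IHhi hIHhi (I 1) _ (by simp) (hI 1) PHhi hPHhi (P 1) (hP 1) N _ _ ?_
      · intro i s _ _
        obtain ⟨-, ⟨e0, e1, e2, e3, e4⟩, -, -⟩ := CornersCubical.edge_C2 f g hfg s
        simp only [hq]
        fin_cases i <;> simp [e0, e1, e2, e3, e4]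
      · intro b
        fin_cases b <;> simp [Finset.sum_filter, Fin.sum_univ_five]
    have TC2V0 :
        NCSeries.evalTrunc N
          (![c, a + b + c, a, e, d] : Fin 5 → DrinfeldKohnoTrunc R (Fin 4) N) PVlo = M 8 := by
      rw [hM]
      refine CornersCubical.side_transport_pl χ hrel ((1 / 2 : ℚ) : ℝ)
        (fun k s => g k 0 s) _ 1 0
        (![none, some 0, none, some 1, some 1] : Fin 5 → Option (Fin 3)) rfl (by decide) ?_
        IVlo hIVlo (I 8) _ (by simp) (hI 8) PVlo hPVlo (P 8) (hP 8) N _ _ ?_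
      · intro i s _ _
        obtain ⟨-, -, ⟨e0, e1, e2, e3, e4⟩, -⟩ := CornersCubical.edge_C2 f g hfg s
        fin_cases i <;> simp [e0, e1, e2, e3, e4]
      · intro b
        fin_cases b <;> simp [Finset.sum_filter, Fin.sum_univ_five]
        abel
    rw [TC2Vh, TC2H0, TC2Hh, TC2V0] at key
    exact key
  have C5 : M 4 * M 14 = M 3 * M 13 := by
    obtain ⟨f, g, hfg, IHlo, IHhi, IVlo, IVhi, hIHlo, hIHhi, hIVlo, hIVhi, PHlo, PHhi, PVlo, PVhi,
      hPHlo, hPHhi, hPVlo, hPVhi, key⟩ := CornersCubical.chart_C5 CP R χ hrel hmul hunit N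
      (![a, e, c, a + b + c, d] : Fin 5 → DrinfeldKohnoTrunc R (Fin 4) N)
      (by subst ha hb hc hd he; rfl)
    have TC5Vh :
        NCSeries.evalTrunc N
          (![a, e, c, a + b + c, d] : Fin 5 → DrinfeldKohnoTrunc R (Fin 4) N) PVhi = M 3 := by
      rw [hM]
      refine CornersCubical.side_transport_pl χ hrel ((1 / 2 : ℚ) : ℝ)
        (fun k s => g k ((1 / 2 : ℚ) : ℝ) s) _ 1 0
        (![none, some 0, none, some 1, some 2] : Fin 5 → Option (Fin 3)) rfl (by decide) ?_
        IVhi hIVhi (I 3) _ (by simp) (hI 3) PVhi hPVhi (P 3) (hP 3) N _ _ ?_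
      · intro i s _ _
        obtain ⟨-, -, -, ⟨e0, e1, e2, e3, e4⟩⟩ := CornersCubical.edge_C5 f g hfg s
        simp only [hq]
        fin_cases i <;> simp [e0, e1, e2, e3, e4]
      · intro b
        fin_cases b <;> simp [Finset.sum_filter, Fin.sum_univ_five]
    have TC5H0 :
        NCSeries.evalTrunc N
          (![a, e, c, a + b + c, d] : Fin 5 → DrinfeldKohnoTrunc R (Fin 4) N) PHlo = M 13 := by
      rw [hM]
      refine CornersCubical.side_transport_pl χ hrel ((1 / 2 : ℚ) : ℝ)
        (fun k s => f k s 0) _ 0 0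
        (![some 0, none, some 1, none, some 1] : Fin 5 → Option (Fin 3)) rfl (by decide) ?_
        IHlo hIHlo (I 13) _ (by simp) (hI 13) PHlo hPHlo (P 13) (hP 13) N _ _ ?_
      · intro i s _ _
        obtain ⟨⟨e0, e1, e2, e3, e4⟩, -, -, -⟩ := CornersCubical.edge_C5 f g hfg s
        fin_cases i <;> simp [e0, e1, e2, e3, e4]
      · intro b
        fin_cases b <;> simp [Finset.sum_filter, Fin.sum_univ_five]
    have TC5Hh :
        NCSeries.evalTrunc N
          (![a, e, c, a + b + c, d] : Fin 5 → DrinfeldKohnoTrunc R (Fin 4) N) PHhi = M 4 := by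
      rw [hM]
      refine CornersCubical.side_transport_pl χ hrel ((1 / 2 : ℚ) : ℝ)
        (fun k s => f k s ((1 / 2 : ℚ) : ℝ)) _ 0 0
        (![some 0, none, some 1, none, some 2] : Fin 5 → Option (Fin 3)) rfl (by decide) ?_
        IHhi hIHhi (I 4) _ (by simp) (hI 4) PHhi hPHhi (P 4) (hP 4) N _ _ ?_
      · intro i s _ _
        obtain ⟨-, ⟨e0, e1, e2, e3, e4⟩, -, -⟩ := CornersCubical.edge_C5 f g hfg s
        simp only [hq]
        fin_cases i <;> simp [e0, e1, e2, e3, e4]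
      · intro b
        fin_cases b <;> simp [Finset.sum_filter, Fin.sum_univ_five]
    have TC5V0 :
        NCSeries.evalTrunc N
          (![a, e, c, a + b + c, d] : Fin 5 → DrinfeldKohnoTrunc R (Fin 4) N) PVlo = M 14 := by
      rw [hM]
      refine CornersCubical.side_transport_pl χ hrel ((1 / 2 : ℚ) : ℝ)
        (fun k s => g k 0 s) _ 1 0
        (![none, some 0, none, some 1, none] : Fin 5 → Option (Fin 3)) rfl (by decide) ?_
        IVlo hIVlo (I 14) _ (by simp) (hI 14) PVlo hPVlo (P 14) (hP 14) N _ _ ?_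
      · intro i s _ _
        obtain ⟨-, -, ⟨e0, e1, e2, e3, e4⟩, -⟩ := CornersCubical.edge_C5 f g hfg s
        fin_cases i <;> simp [e0, e1, e2, e3, e4]
      · intro b
        fin_cases b <;> simp [Finset.sum_filter, Fin.sum_univ_five]
    rw [TC5Vh, TC5H0, TC5Hh, TC5V0] at key
    exact key.symm
  exact ⟨C1, C2, C5⟩

/-- **Sub-stub `cornersCubical_corners`** (the gate's registered hook for this file): the SAME
proposition as `stub_cornersCubical` — the corner principle (hypothesis) implies the three cubical
corner identities `M0M5 = M4M6`, `M0M7 = M1M8`, `M4M14 = M3M13` of the fifteen-path atlas — written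
with inferable binder types and spaces dropped (the registered signature of `stub_cornersCubical`
exceeds the registry's length limit); it is `stub_cornersCubical` itself. [cite: Drinfeld1991, §2] -/
theorem cornersCubical_corners :
    (∀ (R : Type) [CommRing R] [Algebra ℚ R] (χ : KZ.FormalRep →+ R), (∀ c ∈ KZ.relations, χ c = 0)→(∀ x y : KZ.FormalRep, χ (x * y) = χ x * χ y)→(∃ u, χ u = 1)→∀ (m N : ℕ) (α β : ℚ), 0 < α→0 < β→∀ (cf : Fin (m + 2)→Fin 4→ℚ), cf 0 = ![0,1,0,0]→cf 1 = ![0,0,1,0]→∀ (φ f g : Fin (m + 2)→ℝ→ℝ→ℝ), (∀ k x y, φ k x y = cf k 0 + cf k 1 * x + cf k 2 * y + cf k 3 * x * y)→(∀ k x y, f k x y = (cf k 1 + cf k 3 * y) / φ k x y)→(∀ k x y, g k x y = (cf k 2 + cf k 3 * x) / φ k x y)→(∀ k : Fin (m + 2), k ≠ 0→k ≠ 1→∀ x y : ℝ, 0 ≤ x→x ≤ (α : ℝ)→0 ≤ y→y ≤ (β : ℝ)→φ k x y ≠ 0)→∀ (nZ : Fin (m + 2)→Fin 4→Fin 4→ℤ)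 (Zr : Fin (m + 2)→DrinfeldKohnoTrunc ℝ (Fin 4) N), (∀ k, Zr k = ∑ i, ∑ j, (nZ k i j : ℝ) • DrinfeldKohnoTrunc.t ℝ N i j)→Zr 0 * Zr 1 = Zr 1 * Zr 0→(∀ x y : ℝ, 0 < x→x < (α : ℝ)→0 < y→y < (β : ℝ)→∑ k, ∑ l, (f k x y * g l x y) • (Zr k * Zr l - Zr l * Zr k) = 0)→(∀ y : ℝ, 0 < y→y < (β : ℝ)→∑ l, g l 0 y • (Zr 0 * Zr l - Zr l * Zr 0) = 0)→(∀ x : ℝ, 0 < x→x < (α : ℝ)→∑ k, f k x 0 • (Zr 1 * Zr k - Zr k * Zr 1) = 0)→∀ (Hl Hh Vl Vh : (w : List (Fin (m + 2)))→KZ.IntegralRep w.length), (∀ w : List (Fin (m + 2)), w.getLast? ≠ some 0→(Hl w).domain = {t | (∀ i, 0 < t i ∧ t i < (α : ℝ)) ∧ StrictAnti t} ∧ Set.EqOn (Hl w).integrand (fun t => ∏ i, f (w.get i) (t i) 0) (Hl w).domain)→(∀ w : List (Fin (m + 2)), w.getLast? ≠ some 0→(Hh w).domain = {t | (∀ i,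 0 < t i ∧ t i < (α : ℝ)) ∧ StrictAnti t} ∧ Set.EqOn (Hh w).integrand (fun t => ∏ i, f (w.get i) (t i) (β : ℝ)) (Hh w).domain)→(∀ w : List (Fin (m + 2)), w.getLast? ≠ some 1→(Vl w).domain = {t | (∀ i, 0 < t i ∧ t i < (β : ℝ)) ∧ StrictAnti t} ∧ Set.EqOn (Vl w).integrand (fun t => ∏ i, g (w.get i) 0 (t i)) (Vl w).domain)→(∀ w : List (Fin (m + 2)), w.getLast? ≠ some 1→(Vh w).domain = {t | (∀ i, 0 < t i ∧ t i < (β : ℝ)) ∧ StrictAnti t} ∧ Set.EqOn (Vh w).integrand (fun t => ∏ i, g (w.get i) (α : ℝ) (t i)) (Vh w).domain)→∀ (Pl Ph Ql Qh : NCSeries (Fin (m + 2)) R), (∀ W, Pl W = if W = [] then 1 else Shuffle.pair (fun w => χ (KZ.of (Hl w))) (Shuffle.regEnd 0 W))→(∀ W, Ph W = if W = [] then 1 else Shuffle.pair (fun w => χ (KZ.of (Hh w))) (Shuffle.regEnd 0 W))→(∀ W, Ql W = if W = [] then 1 else Shuffle.pair (fun w => χ (KZ.of (Vl w))) (Shuffle.regEnd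 1 W))→(∀ W, Qh W = if W = [] then 1 else Shuffle.pair (fun w => χ (KZ.of (Vh w))) (Shuffle.regEnd 1 W))→∀ (Z : Fin (m + 2)→DrinfeldKohnoTrunc R (Fin 4) N), (∀ k, Z k = ∑ i, ∑ j, (nZ k i j : R) • DrinfeldKohnoTrunc.t R N i j)→NCSeries.evalTrunc N Z Qh * NCSeries.evalTrunc N Z Pl = NCSeries.evalTrunc N Z Ph * NCSeries.evalTrunc N Z Ql)→∀ (R : Type) [CommRing R] [Algebra ℚ R] (χ : KZ.FormalRep →+ R), (∀ c ∈ KZ.relations, χ c = 0)→(∀ x y : KZ.FormalRep, χ (x * y) = χ x * χ y)→(∃ u, χ u = 1)→∀ (I : (p : Fin 15)→(w : List (Fin 3))→KZ.IntegralRep w.length), (∀ (p : Fin 15) (w : List (Fin 3)), w.getLast? ≠ some 0→(I p w).domain = {t | (∀ i, 0 < t i ∧ t i < (![1/2,1/2,1/2,1/2,1/2,1/2,1/2,1/2,1/2,1/2,1,1,1/2,1/2,1/2] : Fin 15→ℝ) p) ∧ StrictAnti t} ∧ Set.EqOn (I p w).integrand (fun t => ∏ i, 1 / (t i - (![![0,1,2],![0,1,-1],![0,1,2],![0,1,-1],![0,1,2],![0,1,2],![0,1,2],![0,1,2],![0,1,2],![0,1,2],![0,-1,2],![0,-1,2],![0,1,2],![0,1,2],![0,1,2]]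 : Fin 15→Fin 3→ℝ) p (w.get i))) (I p w).domain)→∀ (P : Fin 15→NCSeries (Fin 3) R), (∀ p W, P p W = if W = [] then 1 else Shuffle.pair (fun w => χ (KZ.of (I p w))) (Shuffle.regEnd 0 W))→∀ (N : ℕ) (a b c d e : DrinfeldKohnoTrunc R (Fin 4) N), a = DrinfeldKohnoTrunc.t R N 0 1→b = DrinfeldKohnoTrunc.t R N 0 2→c = DrinfeldKohnoTrunc.t R N 1 2→d = DrinfeldKohnoTrunc.t R N 1 3→e = DrinfeldKohnoTrunc.t R N 2 3→∀ (M : Fin 15→DrinfeldKohnoTrunc R (Fin 4) N), (∀ p, M p = NCSeries.evalTrunc N ((![![a+b+c,e,d],![c,a,d],![c+d+e,a+a+b+c,d],![e,a+b+c,d],![a,c,d],![a,c,0],![a+b+c,e,0],![c,a,0],![a+b+c,d+e,0],![c+d+e,a+b+c,0],![c,d,0],![e,d,0],![c+d+e,a,0],![a,c+d,0],![e,a+b+c,0]] : Fin 15→Fin 3→DrinfeldKohnoTrunc R (Fin 4) N) p) (P p))→M 0 * M 5 = M 4 * M 6 ∧ M 0 * M 7 = M 1 * M 8 ∧ M 4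 * M 14 = M 3 * M 13 :=
  stub_cornersCubical

end Summit.KontsevichZagierPeriods.FurushoPentagon.PentagonInKZ
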